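import Summits.CriticalPhenomena.SAWScalingLimit.Theses.SAWLeftRightFKG
import Summits.CriticalPhenomena.SAWScalingLimit.Theorems.SAWRenewalTightnessTightIdentificationGlue

/-!
# `SAWLeftRightFKG.Assembly` (stmt-CriticalPhenomena-1885): the Prokhorov glue of the route

Closes the assembly item of route `SAWLeftRightFKG` of the sub-problem `SAWScalingLimit`:

  `Assembly := LeftRightFKG → FKGToTraversalBound → TraversalBoundTight → SubseqIdentification →
    SAWScalingLimit`.

Proof (`sawLeftRightFKG_assembly_proof`): `FKGToTraversalBound` applied to `LeftRightFKG` is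
`SAWTraversalBound` (definitionally) and `TraversalBoundTight` turns it into `EventualTight`,
i.e. tightness along the mesh (`IsTightAlongMesh`) of the pushed critical SAW laws for every
Dobrushin domain and endpoint approximation; `SubseqIdentification`, read through
`IsSubseqLimitLaw`, identifies every subsequential weak limit law which is a probability measure
as the chordal SLE_{8/3} law. The tree's PROVED soft half
`saw_convergesInLawToSLE_of_isTightAlongMesh` (`SAWRenewalTightnessTightIdentificationGlue.lean`:
Prokhorov's theorem + the subsequence principle along `𝓝[>] 0` + uniqueness of the chordal SLE
law, run on the Dirac-padded push-forward laws, which agree with the pushed SAW laws for all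
small `δ` because `SAW.law D.carrier δ (a δ) (b δ)` is a probability measure as soon as `a δ, b δ`
are joined in the finite `Ω_δ`) then gives `ConvergesInLawToSLE (8/3) D` for the SAW curve laws,
which is `SAWScalingLimit = Literature.Probability.RandomPlanarGeometry.SAW.SAWScalingLimit`
unfolded. No named fact is used; axioms are the standard three.

References: P. Billingsley, *Convergence of Probability Measures* (1999), Thm. 5.1 and its
Corollary; H. Duminil-Copin, S. Smirnov, *Conformal invariance of lattice models* (2012), proof
of Thm. 3.13 ("the possible limit being unique, the claim is proved").
-/

noncomputable section

open MeasureTheory Filter Topology Set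
open Literature.Probability.RandomPlanarGeometry Literature.Probability.LatticeModels
open Summit.CriticalPhenomena.SAWScalingLimit.Theses.SAWLeftRightFKG
open scoped ENNReal NNReal

namespace Summit.CriticalPhenomena.SAWScalingLimit.Theorems

/-- **Assembly of route SAWLeftRightFKG** (item stmt-CriticalPhenomena-1885):
`LeftRightFKG → FKGToTraversalBound → TraversalBoundTight → SubseqIdentification →
SAWScalingLimit`. Left–right FKG fed into the one-curve RSW engine gives the Aizenman–Burchard
bound `SAWTraversalBound`, the glue `TraversalBoundTight` gives eventual tightness
(`IsTightAlongMesh`) of the critical SAW curve laws, and with the identification of the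
subsequential limit laws the proved soft half `saw_convergesInLawToSLE_of_isTightAlongMesh`
(Prokhorov + subsequence principle + uniqueness of the SLE_{8/3} law) yields convergence in law
to chordal SLE_{8/3} for every Dobrushin domain and endpoint approximation, i.e.
`SAWScalingLimit`. [folklore] -/
theorem sawLeftRightFKG_assembly_proof :
    Summit.CriticalPhenomena.SAWScalingLimit.Theses.SAWLeftRightFKG.Assembly := by
  unfold Summit.CriticalPhenomena.SAWScalingLimit.Theses.SAWLeftRightFKG.Assembly
  intro h₁ h₂ h₃ h₄ D a b hab
  have hT : EventualTight := h₃ (h₂ h₁)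
  refine saw_convergesInLawToSLE_of_isTightAlongMesh hab (hT D a b hab) ?_
  rintro μ hμ ⟨s, hs, hlim⟩
  exact h₄ D a b hab s μ hs hμ hlim

end Summit.CriticalPhenomena.SAWScalingLimit.Theorems

end
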